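import Literature.Analysis.FluidPDE.CKNMorreyPressureDual
import Literature.Analysis.FluidPDE.CKNMorreyLocalEnergySteps
import Literature.Analysis.FluidPDE.CKNMorreyLocalEnergyProofs
import Literature.Analysis.FluidPDE.CKNMorreySecondTerm
import HarnessLib

/-!
# The pressure term (13.28)–(13.29) of Lemarié-Rieusset 2016, Lemma 13.3: discharge

Analysis/FluidPDE proof file in the decomposition of the named fact
`Literature.Analysis.FluidPDE.LemarieRieusset2016.lemma13_3` (`CKNMorreyLocalEnergy.lean`):
it PROVES the named fact `LemarieRieusset2016.step1_pressureTerm`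
(`CKNMorreyLocalEnergySteps.lean`; Lemarié-Rieusset 2016, §13.9 Step 1, pp. 468–469,
(13.28)–(13.29)): in the standing setting of §13.9,

  `r⁻¹ ∬_{(t-ρ²,t+ρ²)×B(x,3ρ/4)} |p| |u| ≤ C r⁻¹ ρ^{2 + 3/2 - 5/q₀} P_ρ^{1/q₀} U_ρ^{1/2}
      + C (ρ^{1/2}/r) (U_ρ + V_ρ) V_ρ^{1/2}`        (`step1_pressureTerm_holds`).

## Proof (the printed one, pp. 468–469)

The splitting of the localised pressure is done in dual form in `CKNMorreyPressureDual`
(`lintegral_pressure_velocity_le_mixed`): with `I = (t-ρ², t+ρ²)`, `B = B(x, 3ρ/4)`,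

  `∬_{I×B} |p| |u|
      ≤ ∫_I (L₁(ρ/4)⁻³ π(s) ∫_B |u(s)| + K a(s)^{1/2} e(s)^{1/2} (∫_B |u(s)|³)^{1/3}) ds`,

`π(s) = ∫_{B(x,ρ)} |p(s)|`, `a(s) = ∫_{B(x,ρ)} |u(s)|²`, `e(s) = ∫_{B(x,ρ)} |∇ ⊗ u(s)|²`. Then, as
printed:

* (13.28): "`‖u‖_{L^{q₀/(q₀-1)}_t L¹_x} ≤ C ρ^{2(1-1/q₀)} ρ^{3/2} U_ρ^{1/2}`": slice-wise
  `∫_B |u(s)| ≤ |B(x,ρ)|^{1/2} a(s)^{1/2} ≤ |B(x,ρ)|^{1/2} U_ρ^{1/2}` (Cauchy–Schwarz and the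
  essential supremum), and `∫_I π = ∬_{Q_ρ} |p| ≤ |Q_ρ|^{1-1/q₀} P_ρ^{1/q₀}` (Hölder), with
  `|B(x,ρ)| = |B₁| ρ³`, `|Q_ρ| = 2|B₁| ρ⁵`: the first term is at most
  `64 L₁ |B₁|^{1/2} (2|B₁|)^{1-1/q₀} ρ^{-3+3/2+5(1-1/q₀)} P_ρ^{1/q₀} U_ρ^{1/2}`, and
  `-3 + 3/2 + 5 - 5/q₀ = 2 + 3/2 - 5/q₀`;
* (13.29): "`‖q_{ρ,x}‖_{L^{3/2}_{t,x}} ≤ C ρ^{1/3} U_ρ^{1/2} V_ρ^{1/2}`" and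
  "`(∬_{Q_ρ} |u|³)^{1/3} ≤ C ρ^{1/6} (U_ρ + V_ρ)^{1/2}`": by Cauchy–Schwarz in time,
  `∫_I a^{1/2} e^{1/2} c^{1/3} ≤ U_ρ^{1/2} V_ρ^{1/2} (∫_I c^{2/3})^{1/2}`,
  `c(s) = ∫_{B(x,ρ)} |u(s)|³`, then Hölder `∫_I c^{2/3} ≤ |I|^{1/3} W_ρ^{2/3}` (`|I| = 2ρ²`) and the
  interpolation inequality `W_ρ ≤ C_W ρ^{1/2} (U_ρ + V_ρ)^{3/2}` (`cubicW_le_holds`): the second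
  term is at most
  `K C_W^{1/3} 2^{1/6} ρ^{1/2} U_ρ^{1/2} (U_ρ + V_ρ)^{1/2} V_ρ^{1/2}
    ≤ C ρ^{1/2} (U_ρ + V_ρ) V_ρ^{1/2}`.

The rooms `Q_ρ ⊆ Q_{2ρ} ⊆ Q_{4r₀}(t₀,x₀) ⊆ Ω` and the finiteness of `U_ρ, V_ρ, P_ρ` come from the
standing hypotheses (`CKNMorreyReduced`).

## References

* P. G. Lemarié-Rieusset, *The Navier–Stokes Problem in the 21st Century*, CRC Press (2016),
  §13.9 Step 1, pp. 468–469, (13.28)–(13.29); Lemma 13.3, p. 470. [LemarieRieusset2016]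
-/

noncomputable section

open MeasureTheory Set Function Filter Topology TopologicalSpace Metric InnerProductSpace
open scoped ENNReal NNReal RealInnerProductSpace

namespace Literature.Analysis.FluidPDE

/-! ### Exponent bookkeeping in `[0, ∞]` -/

/-- The powers of `ρ` in (13.28): with `R = ρ`,
`R⁻³ (R³ b)^{1/2} (2R² · R³ b)^{1-1/q₀} = b^{1/2} (2b)^{1-1/q₀} R^{7/2 - 5/q₀}`. [folklore] -/
theorem rpow_bookkeeping_harmonic {R b : ℝ≥0∞} (hR : R ≠ 0) (hR' : R ≠ ∞) {q₀ : ℝ}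
    (hq : 0 ≤ 1 - 1 / q₀) :
    R ^ (-(3 : ℝ)) * (R ^ (3 : ℝ) * b) ^ (1 / 2 : ℝ) *
        (2 * R ^ (2 : ℝ) * (R ^ (3 : ℝ) * b)) ^ (1 - 1 / q₀) =
      b ^ (1 / 2 : ℝ) * (2 * b) ^ (1 - 1 / q₀) * R ^ (7 / 2 - 5 / q₀ : ℝ) := by
  have e1 : (R ^ (3 : ℝ) * b) ^ (1 / 2 : ℝ) = R ^ (3 / 2 : ℝ) * b ^ (1 / 2 : ℝ) := by
    rw [ENNReal.mul_rpow_of_nonneg _ _ (by norm_num), ← ENNReal.rpow_mul]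
    norm_num
  have e2 : 2 * R ^ (2 : ℝ) * (R ^ (3 : ℝ) * b) = (2 * b) * R ^ (5 : ℝ) := by
    rw [show (5 : ℝ) = 2 + 3 by norm_num, ENNReal.rpow_add _ _ hR hR']
    ring
  have e3 : ((2 * b) * R ^ (5 : ℝ)) ^ (1 - 1 / q₀) =
      (2 * b) ^ (1 - 1 / q₀) * R ^ (5 * (1 - 1 / q₀)) := by
    rw [ENNReal.mul_rpow_of_nonneg _ _ hq, ← ENNReal.rpow_mul]
  rw [e1, e2, e3]
  have e4 : R ^ (-(3 : ℝ)) * R ^ (3 / 2 : ℝ) * R ^ (5 * (1 - 1 / q₀)) =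
      R ^ (7 / 2 - 5 / q₀ : ℝ) := by
    rw [← ENNReal.rpow_add _ _ hR hR', ← ENNReal.rpow_add _ _ hR hR']
    congr 1
    ring
  calc R ^ (-(3 : ℝ)) * (R ^ (3 / 2 : ℝ) * b ^ (1 / 2 : ℝ)) *
        ((2 * b) ^ (1 - 1 / q₀) * R ^ (5 * (1 - 1 / q₀)))
      = b ^ (1 / 2 : ℝ) * (2 * b) ^ (1 - 1 / q₀) *
          (R ^ (-(3 : ℝ)) * R ^ (3 / 2 : ℝ) * R ^ (5 * (1 - 1 / q₀))) := by ring
    _ = b ^ (1 / 2 : ℝ) * (2 * b) ^ (1 - 1 / q₀) * R ^ (7 / 2 - 5 / q₀ : ℝ) := by rw [e4]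

/-- The powers of `ρ` in (13.29): with `R = ρ`,
`((C_W R^{1/2} (U+V)^{3/2})^{2/3} (2R²)^{1/3})^{1/2} = C_W^{1/3} 2^{1/6} R^{1/2} (U+V)^{1/2}`.
[folklore] -/
theorem rpow_bookkeeping_cubic {R : ℝ≥0∞} (hR : R ≠ 0) (hR' : R ≠ ∞) (CW X : ℝ≥0∞) :
    ((CW * R ^ (1 / 2 : ℝ) * X ^ (3 / 2 : ℝ)) ^ (2 / 3 : ℝ) * (2 * R ^ (2 : ℝ)) ^ (1 / 3 : ℝ)) ^
        (1 / 2 : ℝ) =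
      CW ^ (1 / 3 : ℝ) * 2 ^ (1 / 6 : ℝ) * R ^ (1 / 2 : ℝ) * X ^ (1 / 2 : ℝ) := by
  have e1 : (CW * R ^ (1 / 2 : ℝ) * X ^ (3 / 2 : ℝ)) ^ (2 / 3 : ℝ) =
      CW ^ (2 / 3 : ℝ) * R ^ (1 / 3 : ℝ) * X := by
    rw [ENNReal.mul_rpow_of_nonneg _ _ (by norm_num), ENNReal.mul_rpow_of_nonneg _ _ (by norm_num),
      ← ENNReal.rpow_mul, ← ENNReal.rpow_mul]
    norm_num
  have e2 : (2 * R ^ (2 : ℝ)) ^ (1 / 3 : ℝ) = 2 ^ (1 / 3 : ℝ) * R ^ (2 / 3 : ℝ) := by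
    rw [ENNReal.mul_rpow_of_nonneg _ _ (by norm_num), ← ENNReal.rpow_mul]
    norm_num
  rw [e1, e2]
  have e3 : CW ^ (2 / 3 : ℝ) * R ^ (1 / 3 : ℝ) * X * (2 ^ (1 / 3 : ℝ) * R ^ (2 / 3 : ℝ)) =
      CW ^ (2 / 3 : ℝ) * 2 ^ (1 / 3 : ℝ) * R ^ (1 : ℝ) * X := by
    rw [show (1 : ℝ) = 1 / 3 + 2 / 3 by norm_num, ENNReal.rpow_add _ _ hR hR']
    ring
  rw [e3, ENNReal.mul_rpow_of_nonneg _ _ (by norm_num),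
    ENNReal.mul_rpow_of_nonneg _ _ (by norm_num), ENNReal.mul_rpow_of_nonneg _ _ (by norm_num),
    ← ENNReal.rpow_mul, ← ENNReal.rpow_mul, ← ENNReal.rpow_mul]
  norm_num

/-! ### Volumes of the balls, intervals and cylinders of §13.9 -/

/-- `|B(x, ρ)| = ρ³ |B₁|` in `ℝ³` (`ρ ≥ 0`), with `ρ³` as a real power of `ENNReal.ofReal ρ`.
[folklore] -/
theorem volume_ball_fin3 (x : EuclideanSpace ℝ (Fin 3)) {ρ : ℝ} (hρ : 0 ≤ ρ) :
    volume (ball x ρ) =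
      ENNReal.ofReal ρ ^ (3 : ℝ) * volume (ball (0 : EuclideanSpace ℝ (Fin 3)) 1) := by
  rw [Measure.addHaar_ball volume x hρ, finrank_euclideanSpace_fin, ENNReal.ofReal_pow hρ,
    show (3 : ℝ) = ((3 : ℕ) : ℝ) by norm_num, ENNReal.rpow_natCast]

/-- `|(t - ρ², t + ρ²)| = 2ρ²`, with `ρ²` as a real power of `ENNReal.ofReal ρ` (`ρ ≥ 0`).
[folklore] -/
theorem volume_Ioo_sq {t ρ : ℝ} (hρ : 0 ≤ ρ) :
    volume (Ioo (t - ρ ^ 2) (t + ρ ^ 2)) = 2 * ENNReal.ofReal ρ ^ (2 : ℝ) := by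
  rw [Real.volume_Ioo, show t + ρ ^ 2 - (t - ρ ^ 2) = 2 * ρ ^ 2 by ring,
    ENNReal.ofReal_mul (by norm_num), ENNReal.ofReal_ofNat, ENNReal.ofReal_pow hρ,
    show (2 : ℝ) = ((2 : ℕ) : ℝ) by norm_num, ENNReal.rpow_natCast]

/-- `(ρ/4)⁻³` as a power of `ENNReal.ofReal ρ`: `ofReal (L (ρ/4)⁻³) = ofReal (64 L) · R⁻³` (`ρ > 0`,
`L ≥ 0`). [folklore] -/
theorem ofReal_mul_inv_quarter_cube {L ρ : ℝ} (hL : 0 ≤ L) (hρ : 0 < ρ) :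
    ENNReal.ofReal (L * (ρ / 4)⁻¹ ^ 3) =
      ENNReal.ofReal (L * 64) * ENNReal.ofReal ρ ^ (-(3 : ℝ)) := by
  have h1 : L * (ρ / 4)⁻¹ ^ 3 = (L * 64) * (ρ ^ 3)⁻¹ := by
    field_simp
    ring
  rw [h1, ENNReal.ofReal_mul (by positivity), ENNReal.ofReal_inv_of_pos (by positivity),
    ENNReal.ofReal_pow hρ.le, ENNReal.rpow_neg, show (3 : ℝ) = ((3 : ℕ) : ℝ) by norm_num,
    ENNReal.rpow_natCast]

namespace LemarieRieusset2016

variable {Ω : Opens (ℝ × EuclideanSpace ℝ (Fin 3))} {ν q₀ : ℝ}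
  {f u : ℝ → EuclideanSpace ℝ (Fin 3) → EuclideanSpace ℝ (Fin 3)}
  {p : ℝ → EuclideanSpace ℝ (Fin 3) → ℝ}
  {G : ℝ → EuclideanSpace ℝ (Fin 3) → EuclideanSpace ℝ (Fin 3) →L[ℝ] EuclideanSpace ℝ (Fin 3)}

/-- Under the standing hypotheses of §13.9 the force `f ∈ L^{10/7}(Ω)` is locally integrable on
`Ω`. [folklore] -/
theorem IsSuitableOn.locallyIntegrableOn_force (hS : IsSuitableOn Ω ν q₀ f u p G) :
    LocallyIntegrableOn (uncurry f) (Ω : Set (ℝ × EuclideanSpace ℝ (Fin 3))) volume := by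
  rw [locallyIntegrableOn_iff Ω.isOpen.isLocallyClosed]
  intro K hKΩ hK
  have h1 : MemLp (uncurry f) (ENNReal.ofReal (10 / 7)) (volume.restrict K) :=
    hS.force_memLp.mono_measure (Measure.restrict_mono hKΩ le_rfl)
  haveI : IsFiniteMeasure ((volume : Measure (ℝ × EuclideanSpace ℝ (Fin 3))).restrict K) :=
    ⟨by rw [Measure.restrict_apply_univ]; exact hK.measure_lt_top⟩
  exact memLp_one_iff_integrable.1 (h1.mono_exponent (ENNReal.one_le_ofReal.2 (by norm_num)))

/-- **Discharge of the named fact `step1_pressureTerm`: the pressure term (13.28)–(13.29) of the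
local energy inequality** (Lemarié-Rieusset 2016, §13.9 Step 1, pp. 468–469). Let `ν > 0`,
`1 < q₀ ≤ 3/2`. There is `C = C(ν, q₀)` such that for `IsSuitableOn Ω ν q₀ f u p G`,
`Q_{4r₀}(t₀,x₀) ⊆ Ω`, `(t,x) ∈ Q_{r₀}(t₀,x₀)` and `0 < r ≤ ρ/2 ≤ r₀/2`,
`r⁻¹ ∬_{(t-ρ²,t+ρ²)×B(x,3ρ/4)} |p| |u| ≤ C r⁻¹ ρ^{2 + 3/2 - 5/q₀} P_ρ^{1/q₀} U_ρ^{1/2}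
 + C (ρ^{1/2}/r) (U_ρ + V_ρ) V_ρ^{1/2}`. PROVED: the dual splitting of the localised pressure
(`lintegral_pressure_velocity_le_mixed`: pressure equation tested with truncated Newtonian
potentials, harmonic part by the far-field kernel bound, Calderón–Zygmund part slice-wise by
Stein's `L³` bound and the Poincaré–Sobolev inequality) followed by the printed Hölder
bookkeeping in time (Cauchy–Schwarz on `B(x,ρ)` and in time,
`∬_{Q_ρ}|p| ≤ |Q_ρ|^{1-1/q₀}P_ρ^{1/q₀}`,
`∫_I c^{2/3} ≤ |I|^{1/3} W_ρ^{2/3}`, `W_ρ ≤ C_W ρ^{1/2}(U_ρ+V_ρ)^{3/2}`), see the module docstring.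
[cite: LemarieRieusset2016, §13.9 (13.28)–(13.29) p. 469] -/
theorem step1_pressureTerm_holds : step1_pressureTerm := by
  intro ν q₀ hν hq₀ hq₀'
  obtain ⟨L₁, hL₁⟩ := exists_newtonFarLaplacian_half_bound
  obtain ⟨K, hK⟩ := exists_hessian_slice_bound
  obtain ⟨CW, hCW⟩ := cubicW_le_holds
  -- ### the constant
  set b₁ : ℝ≥0∞ := volume (ball (0 : EuclideanSpace ℝ (Fin 3)) 1) with hb₁
  have hb₁top : b₁ ≠ ∞ := measure_ball_lt_top.ne
  have hq1 : 0 ≤ 1 - 1 / q₀ := by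
    rw [sub_nonneg, div_le_one (by linarith)]; exact hq₀.le
  set C₁ : ℝ≥0∞ := ENNReal.ofReal (L₁ * 64) * (b₁ ^ (1 / 2 : ℝ) * (2 * b₁) ^ (1 - 1 / q₀))
    with hC₁
  set C₂ : ℝ≥0∞ := (K : ℝ≥0∞) * (CW ^ (1 / 3 : ℝ) * 2 ^ (1 / 6 : ℝ)) with hC₂
  have hC₁top : C₁ ≠ ∞ :=
    ENNReal.mul_ne_top ENNReal.ofReal_ne_top (ENNReal.mul_ne_top
      (ENNReal.rpow_ne_top_of_nonneg (by norm_num) hb₁top)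
      (ENNReal.rpow_ne_top_of_nonneg hq1 (ENNReal.mul_ne_top (by norm_num) hb₁top)))
  have hC₂top : C₂ ≠ ∞ :=
    ENNReal.mul_ne_top ENNReal.coe_ne_top (ENNReal.mul_ne_top
      (ENNReal.rpow_ne_top_of_nonneg (by norm_num) ENNReal.coe_ne_top)
      (ENNReal.rpow_ne_top_of_nonneg (by norm_num) (by norm_num)))
  have hCsum : C₁ + C₂ ≠ ∞ := ENNReal.add_ne_top.2 ⟨hC₁top, hC₂top⟩
  refine ⟨(C₁ + C₂).toNNReal, ?_⟩
  intro Ω f u p G hS z₀ r₀ hr₀ hΩ z hz r ρ hr hrρ hρr₀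
  have hρ : 0 < ρ := by linarith
  rw [ENNReal.coe_toNNReal hCsum]
  -- ### rooms and finiteness
  have h2ρ : parabolicCylinderCentered (2 * ρ) z ⊆ (Ω : Set (ℝ × EuclideanSpace ℝ (Fin 3))) :=
    (parabolicCylinderCentered_two_mul_subset hz hρ hρr₀).trans hΩ
  have hρΩ : parabolicCylinderCentered ρ z ⊆ (Ω : Set (ℝ × EuclideanSpace ℝ (Fin 3))) :=
    (parabolicCylinderCentered_mono hρ.le (by linarith) z).trans h2ρ
  have hle2 : parabolicCylinderCenteredOpens (2 * ρ) z ≤ Ω := h2ρ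
  have hG2 : HasWeakSpatialGradientOn (parabolicCylinderCenteredOpens (2 * ρ) z) u G :=
    hS.hasWeakSpatialGradientOn.mono hle2
  have hle1 : parabolicCylinderCenteredOpens ρ z ≤ parabolicCylinderCenteredOpens (2 * ρ) z :=
    parabolicCylinderCentered_mono hρ.le (by linarith) z
  have hG1 : HasWeakSpatialGradientOn (parabolicCylinderCenteredOpens ρ z) u G := hG2.mono hle1
  obtain ⟨Ce, hCe⟩ := hS.energy
  have hU : energyU u ρ z ≠ ∞ :=
    ne_top_of_le_ne_top ENNReal.coe_ne_top (energyU_le_of_subset hCe hρΩ)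
  have hV : gradV G ρ z ≠ ∞ := (gradV_lt_top_of_subset hS.gradient_sq_lt_top hρΩ).ne
  have hP : pressureP p q₀ ρ z ≠ ∞ := (pressureP_lt_top_of_subset hS.pressure_lt_top hρΩ).ne
  -- ### geometry and measures
  set a : ℝ := z.1 - ρ ^ 2 with ha_def
  set b : ℝ := z.1 + ρ ^ 2 with hb_def
  set I : Set ℝ := Ioo a b with hI
  set B₃ : Set (EuclideanSpace ℝ (Fin 3)) := ball z.2 (3 / 4 * ρ) with hB₃
  set Bρ : Set (EuclideanSpace ℝ (Fin 3)) := ball z.2 ρ with hBρ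
  set S : Set (ℝ × EuclideanSpace ℝ (Fin 3)) := I ×ˢ B₃ with hSdef
  set Q : Set (ℝ × EuclideanSpace ℝ (Fin 3)) := I ×ˢ Bρ with hQ
  have hQeq : parabolicCylinderCentered ρ z = Q := rfl
  have hB₃ρ : B₃ ⊆ Bρ := ball_subset_ball (by linarith)
  have hSQ : S ⊆ Q := Set.prod_mono Subset.rfl hB₃ρ
  have hprodQ : ((volume : Measure (ℝ × EuclideanSpace ℝ (Fin 3))).restrict Q) =
      (volume.restrict I).prod (volume.restrict Bρ) := by
    rw [hQ, Measure.volume_eq_prod, Measure.prod_restrict]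
  have hprodS : ((volume : Measure (ℝ × EuclideanSpace ℝ (Fin 3))).restrict S) =
      (volume.restrict I).prod (volume.restrict B₃) := by
    rw [hSdef, Measure.volume_eq_prod, Measure.prod_restrict]
  set R : ℝ≥0∞ := ENNReal.ofReal ρ with hR
  have hR0 : R ≠ 0 := (ENNReal.ofReal_pos.2 hρ).ne'
  have hRtop : R ≠ ∞ := ENNReal.ofReal_ne_top
  have hvolB : volume Bρ = R ^ (3 : ℝ) * b₁ := volume_ball_fin3 z.2 hρ.le
  have hvolI : volume I = 2 * R ^ (2 : ℝ) := volume_Ioo_sq hρ.le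
  have hvolQ : volume Q = 2 * R ^ (2 : ℝ) * (R ^ (3 : ℝ) * b₁) := by
    rw [hQ, Measure.volume_eq_prod, Measure.prod_prod, hvolI, hvolB]
  have hIfin : volume I ≠ ∞ := measure_Ioo_lt_top.ne
  have hQfin : volume Q ≠ ∞ := by
    rw [hvolQ]
    exact ENNReal.mul_ne_top (ENNReal.mul_ne_top (by norm_num)
      (ENNReal.rpow_ne_top_of_nonneg (by norm_num) hRtop))
      (ENNReal.mul_ne_top (ENNReal.rpow_ne_top_of_nonneg (by norm_num) hRtop) hb₁top)
  -- ### measurability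
  have hum : AEStronglyMeasurable (uncurry u)
      ((volume : Measure (ℝ × EuclideanSpace ℝ (Fin 3))).restrict Q) :=
    hG1.locallyIntegrableOn.aestronglyMeasurable
  have hGm : AEStronglyMeasurable (uncurry G)
      ((volume : Measure (ℝ × EuclideanSpace ℝ (Fin 3))).restrict Q) :=
    hG1.locallyIntegrableOn_grad.aestronglyMeasurable
  have hpm : AEStronglyMeasurable (uncurry p)
      ((volume : Measure (ℝ × EuclideanSpace ℝ (Fin 3))).restrict Q) :=
    (hS.solution.2.2.1.mono_set hρΩ).aestronglyMeasurable
  have hum1 : AEMeasurable (fun w : ℝ × EuclideanSpace ℝ (Fin 3) => ‖u w.1 w.2‖ₑ)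
      ((volume.restrict I).prod (volume.restrict B₃)) := by
    rw [← hprodS]; exact (hum.mono_measure (Measure.restrict_mono hSQ le_rfl)).enorm
  have hum3 : AEMeasurable (fun w : ℝ × EuclideanSpace ℝ (Fin 3) => ‖u w.1 w.2‖ₑ ^ (3 : ℝ))
      ((volume.restrict I).prod (volume.restrict Bρ)) := by
    rw [← hprodQ]; exact hum.enorm.pow_const _
  have hGm2 : AEMeasurable (fun w : ℝ × EuclideanSpace ℝ (Fin 3) =>
      ENNReal.ofReal (frobeniusNormSq (G w.1 w.2)))
      ((volume.restrict I).prod (volume.restrict Bρ)) := by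
    rw [← hprodQ]
    exact (continuous_frobeniusNormSq'.comp_aestronglyMeasurable
      hGm).aemeasurable.ennreal_ofReal
  have hpm1 : AEMeasurable (fun w : ℝ × EuclideanSpace ℝ (Fin 3) => ‖p w.1 w.2‖ₑ)
      ((volume.restrict I).prod (volume.restrict Bρ)) := by
    rw [← hprodQ]; exact hpm.enorm
  have hpm1' : AEMeasurable (fun w : ℝ × EuclideanSpace ℝ (Fin 3) => ‖p w.1 w.2‖ₑ)
      ((volume : Measure (ℝ × EuclideanSpace ℝ (Fin 3))).restrict Q) := hpm.enorm
  -- ### the slice quantities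
  set av : ℝ → ℝ≥0∞ := fun s => ∫⁻ y in Bρ, ‖u s y‖ₑ ^ 2 with hav
  set ev : ℝ → ℝ≥0∞ := fun s => ∫⁻ y in Bρ, ENNReal.ofReal (frobeniusNormSq (G s y)) with hev
  set π : ℝ → ℝ≥0∞ := fun s => ∫⁻ y in Bρ, ‖p s y‖ₑ with hπ
  set cv : ℝ → ℝ≥0∞ := fun s => ∫⁻ y in Bρ, ‖u s y‖ₑ ^ (3 : ℝ) with hcv
  set A₁ : ℝ → ℝ≥0∞ := fun s => ∫⁻ y in B₃, ‖u s y‖ₑ with hA₁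
  set A₃ : ℝ → ℝ≥0∞ := fun s => ∫⁻ y in B₃, ‖u s y‖ₑ ^ (3 : ℝ) with hA₃
  have hem : AEMeasurable ev (volume.restrict I) := hGm2.lintegral_prod_right'
  have hπm : AEMeasurable π (volume.restrict I) := hpm1.lintegral_prod_right'
  have hcm : AEMeasurable cv (volume.restrict I) := hum3.lintegral_prod_right'
  have hA₁m : AEMeasurable A₁ (volume.restrict I) := hum1.lintegral_prod_right'
  have hVeq : gradV G ρ z = ∫⁻ s in I, ev s := by
    rw [gradV, hQeq, show ((volume : Measure (ℝ × EuclideanSpace ℝ (Fin 3))).restrict Q) =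
      (volume.restrict I).prod (volume.restrict Bρ) from hprodQ, lintegral_prod _ hGm2]
  have hWeq : cubicW u ρ z = ∫⁻ s in I, cv s := by
    rw [cubicW, hQeq, show ((volume : Measure (ℝ × EuclideanSpace ℝ (Fin 3))).restrict Q) =
      (volume.restrict I).prod (volume.restrict Bρ) from hprodQ, lintegral_prod _ hum3]
  have hπeq : ∫⁻ w in Q, ‖p w.1 w.2‖ₑ = ∫⁻ s in I, π s := by
    rw [show ((volume : Measure (ℝ × EuclideanSpace ℝ (Fin 3))).restrict Q) =
      (volume.restrict I).prod (volume.restrict Bρ) from hprodQ, lintegral_prod _ hpm1]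
  -- ### `p ∈ L¹(Q_ρ)` and the mixed bound
  have hPQ : ∫⁻ w in Q, ‖p w.1 w.2‖ₑ ≤
      pressureP p q₀ ρ z ^ (1 / q₀) * volume Q ^ (1 - 1 / q₀) := by
    have h := setLIntegral_rpow_le_rpow_mul_measure_of_le volume Q hpm1' (a := 1) (c := q₀)
      one_pos hq₀.le
    simp only [ENNReal.rpow_one] at h
    exact h
  have hpint : IntegrableOn (uncurry p) Q volume := by
    refine ⟨hpm, ?_⟩
    rw [hasFiniteIntegral_iff_enorm]
    refine lt_of_le_of_lt hPQ ?_
    exact ENNReal.mul_lt_top (ENNReal.rpow_lt_top_of_nonneg (by positivity) hP)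
      (ENNReal.rpow_lt_top_of_nonneg hq1 hQfin)
  have hmix := lintegral_pressure_velocity_le_mixed hS.solution hS.locallyIntegrableOn_force
    hS.divFree_force hρ hρΩ hG1 hU hV hpint hL₁ hK
  -- ### a.e. in time
  have h1ae : ∀ᵐ s ∂(volume.restrict I), av s ≤ energyU u ρ z := ENNReal.ae_le_essSup _
  have h3ae : ∀ᵐ s ∂(volume.restrict I), FunctionSpaces.HasWeakFDerivOn
      (⟨ball z.2 ρ, isOpen_ball⟩ : Opens (EuclideanSpace ℝ (Fin 3))) volume (u s) (G s) :=
    hG1.ae_hasWeakFDerivOn_slice (Ω := (⟨ball z.2 ρ, isOpen_ball⟩ :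
      Opens (EuclideanSpace ℝ (Fin 3))))
  -- ### Term 1, slice-wise: `∫_B |u(s)| ≤ |B_ρ|^{1/2} U^{1/2}` (Cauchy–Schwarz)
  set c₁ : ℝ≥0∞ := ENNReal.ofReal (L₁ * (ρ / 4)⁻¹ ^ 3) with hc₁def
  have hT1slice : ∀ᵐ s ∂(volume.restrict I),
      A₁ s ≤ energyU u ρ z ^ (1 / 2 : ℝ) * volume Bρ ^ (1 / 2 : ℝ) := by
    filter_upwards [h1ae, h3ae] with s h1 h3
    have husm : AEStronglyMeasurable (u s) (volume.restrict Bρ) :=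
      h3.locallyIntegrableOn.aestronglyMeasurable
    have hpq : (2 : ℝ).HolderConjugate 2 := Real.holderConjugate_iff.2 ⟨by norm_num, by norm_num⟩
    have key := ENNReal.lintegral_mul_le_Lp_mul_Lq (volume.restrict Bρ) hpq husm.enorm
      (g := fun _ => (1 : ℝ≥0∞)) aemeasurable_const
    have hav2 : (∫⁻ y in Bρ, ‖u s y‖ₑ ^ (2 : ℝ)) = av s := by
      rw [hav]
      refine lintegral_congr fun y => ?_
      rw [show (2 : ℝ) = ((2 : ℕ) : ℝ) by norm_num, ENNReal.rpow_natCast]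
    have key' : ∫⁻ y in Bρ, ‖u s y‖ₑ ≤
        (∫⁻ y in Bρ, ‖u s y‖ₑ ^ (2 : ℝ)) ^ (1 / (2 : ℝ)) * volume Bρ ^ (1 / (2 : ℝ)) := by
      have e_l : (fun y => ((fun x : EuclideanSpace ℝ (Fin 3) => ‖u s x‖ₑ) *
          (fun _ : EuclideanSpace ℝ (Fin 3) => (1 : ℝ≥0∞))) y) = fun y => ‖u s y‖ₑ := by
        funext y; rw [Pi.mul_apply, mul_one]
      have e_r : (∫⁻ y in Bρ, (fun _ : EuclideanSpace ℝ (Fin 3) => (1 : ℝ≥0∞)) y ^ (2 : ℝ)) =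
          volume Bρ := by
        rw [lintegral_congr (g := fun _ => 1) fun y => by rw [ENNReal.one_rpow],
          lintegral_const, Measure.restrict_apply_univ, one_mul]
      rw [e_l, e_r] at key
      exact key
    rw [hav2] at key'
    calc A₁ s ≤ ∫⁻ y in Bρ, ‖u s y‖ₑ := lintegral_mono_set hB₃ρ
      _ ≤ av s ^ (1 / (2 : ℝ)) * volume Bρ ^ (1 / (2 : ℝ)) := key'
      _ ≤ energyU u ρ z ^ (1 / 2 : ℝ) * volume Bρ ^ (1 / 2 : ℝ) := by gcongr
  have hπQ : ∫⁻ s in I, π s ≤ pressureP p q₀ ρ z ^ (1 / q₀) * volume Q ^ (1 - 1 / q₀) := by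
    rw [← hπeq]; exact hPQ
  -- ### Term 2, slice-wise, and the inputs in time
  have hT2slice : ∀ᵐ s ∂(volume.restrict I),
      (K * av s ^ (1 / 2 : ℝ) * ev s ^ (1 / 2 : ℝ)) * A₃ s ^ (1 / (3 : ℝ)) ≤
        K * energyU u ρ z ^ (1 / 2 : ℝ) * (ev s ^ (1 / 2 : ℝ) * cv s ^ (1 / 3 : ℝ)) := by
    filter_upwards [h1ae] with s h1
    have hA : A₃ s ≤ cv s := lintegral_mono_set hB₃ρ
    calc (K * av s ^ (1 / 2 : ℝ) * ev s ^ (1 / 2 : ℝ)) * A₃ s ^ (1 / (3 : ℝ))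
        ≤ (K * energyU u ρ z ^ (1 / 2 : ℝ) * ev s ^ (1 / 2 : ℝ)) * cv s ^ (1 / (3 : ℝ)) := by
          gcongr
      _ = K * energyU u ρ z ^ (1 / 2 : ℝ) * (ev s ^ (1 / 2 : ℝ) * cv s ^ (1 / 3 : ℝ)) := by
          rw [one_div (3 : ℝ)]; ring_nf
  have hcv23 : ∫⁻ s in I, cv s ^ (2 / 3 : ℝ) ≤
      (∫⁻ s in I, cv s) ^ (2 / 3 : ℝ) * volume I ^ (1 / 3 : ℝ) := by
    have h := setLIntegral_rpow_le_rpow_mul_measure volume I hcm (a := 2 / 3) (b := 1)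
      (by norm_num) (by norm_num)
    simp only [ENNReal.rpow_one] at h
    convert h using 2 <;> norm_num
  have hW : (∫⁻ s in I, cv s) ≤
      CW * ENNReal.ofReal (ρ ^ (1 / 2 : ℝ)) * (energyU u ρ z + gradV G ρ z) ^ (3 / 2 : ℝ) := by
    rw [← hWeq]; exact hCW u G z ρ hρ hG2
  -- ### abbreviate the quantities at scale `ρ`
  generalize hUg : energyU u ρ z = U at hU hT1slice hT2slice hW ⊢
  generalize hVg : gradV G ρ z = V at hV hVeq hW ⊢
  generalize hPg : pressureP p q₀ ρ z = P at hP hπQ ⊢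
  -- ### Term 1: `∫_I c₁ π A₁ ≤ c₁ U^{1/2} |B_ρ|^{1/2} P^{1/q₀} |Q|^{1-1/q₀}`
  have hT1 : ∫⁻ s in I, (c₁ * π s) * A₁ s ≤
      c₁ * (U ^ (1 / 2 : ℝ) * volume Bρ ^ (1 / 2 : ℝ)) *
        (P ^ (1 / q₀) * volume Q ^ (1 - 1 / q₀)) :=
    calc ∫⁻ s in I, (c₁ * π s) * A₁ s
        ≤ ∫⁻ s in I, (c₁ * π s) * (U ^ (1 / 2 : ℝ) * volume Bρ ^ (1 / 2 : ℝ)) :=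
          lintegral_mono_ae (hT1slice.mono fun s hs => mul_le_mul_right hs _)
      _ = (∫⁻ s in I, c₁ * π s) * (U ^ (1 / 2 : ℝ) * volume Bρ ^ (1 / 2 : ℝ)) :=
          lintegral_mul_const'' _ (hπm.const_mul _)
      _ = c₁ * (∫⁻ s in I, π s) * (U ^ (1 / 2 : ℝ) * volume Bρ ^ (1 / 2 : ℝ)) := by
          rw [lintegral_const_mul'' _ hπm]
      _ ≤ c₁ * (P ^ (1 / q₀) * volume Q ^ (1 - 1 / q₀)) *
            (U ^ (1 / 2 : ℝ) * volume Bρ ^ (1 / 2 : ℝ)) := by gcongr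
      _ = c₁ * (U ^ (1 / 2 : ℝ) * volume Bρ ^ (1 / 2 : ℝ)) *
            (P ^ (1 / q₀) * volume Q ^ (1 - 1 / q₀)) := by ring
  -- ### Term 2: `∫_I K a^{1/2} e^{1/2} A₃^{1/3} ≤ K U^{1/2} V^{1/2} (|I|^{1/3} W^{2/3})^{1/2}`
  have hT2 : ∫⁻ s in I, (K * av s ^ (1 / 2 : ℝ) * ev s ^ (1 / 2 : ℝ)) * A₃ s ^ (1 / (3 : ℝ)) ≤
      K * U ^ (1 / 2 : ℝ) * (V ^ (1 / 2 : ℝ) *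
        ((CW * ENNReal.ofReal (ρ ^ (1 / 2 : ℝ)) * (U + V) ^ (3 / 2 : ℝ)) ^ (2 / 3 : ℝ) *
          volume I ^ (1 / 3 : ℝ)) ^ (1 / 2 : ℝ)) :=
    calc ∫⁻ s in I, (K * av s ^ (1 / 2 : ℝ) * ev s ^ (1 / 2 : ℝ)) * A₃ s ^ (1 / (3 : ℝ))
        ≤ ∫⁻ s in I, K * U ^ (1 / 2 : ℝ) * (ev s ^ (1 / 2 : ℝ) * cv s ^ (1 / 3 : ℝ)) :=
          lintegral_mono_ae hT2slice
      _ = K * U ^ (1 / 2 : ℝ) * ∫⁻ s in I, ev s ^ (1 / 2 : ℝ) * cv s ^ (1 / 3 : ℝ) :=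
          lintegral_const_mul'' _ ((hem.pow_const _).mul (hcm.pow_const _))
      _ ≤ K * U ^ (1 / 2 : ℝ) *
            ((∫⁻ s in I, ev s) ^ (1 / 2 : ℝ) * (∫⁻ s in I, cv s ^ (2 / 3 : ℝ)) ^ (1 / 2 : ℝ)) := by
          gcongr
          exact lintegral_rpow_half_mul_rpow_third_le _ hem hcm
      _ ≤ K * U ^ (1 / 2 : ℝ) * (V ^ (1 / 2 : ℝ) *
            ((∫⁻ s in I, cv s) ^ (2 / 3 : ℝ) * volume I ^ (1 / 3 : ℝ)) ^ (1 / 2 : ℝ)) := by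
          rw [← hVeq]
          gcongr
      _ ≤ K * U ^ (1 / 2 : ℝ) * (V ^ (1 / 2 : ℝ) *
            ((CW * ENNReal.ofReal (ρ ^ (1 / 2 : ℝ)) * (U + V) ^ (3 / 2 : ℝ)) ^ (2 / 3 : ℝ) *
              volume I ^ (1 / 3 : ℝ)) ^ (1 / 2 : ℝ)) := by
          gcongr
  -- ### the two terms in closed form
  have hc₁ : c₁ = ENNReal.ofReal (L₁ * 64) * R ^ (-(3 : ℝ)) :=
    ofReal_mul_inv_quarter_cube L₁.2 hρ
  have hterm1 : c₁ * (U ^ (1 / 2 : ℝ) * volume Bρ ^ (1 / 2 : ℝ)) *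
      (P ^ (1 / q₀) * volume Q ^ (1 - 1 / q₀)) =
        C₁ * R ^ (7 / 2 - 5 / q₀ : ℝ) * P ^ (1 / q₀) * U ^ (1 / 2 : ℝ) := by
    rw [hc₁, hvolB, hvolQ]
    calc ENNReal.ofReal (L₁ * 64) * R ^ (-(3 : ℝ)) *
          (U ^ (1 / 2 : ℝ) * (R ^ (3 : ℝ) * b₁) ^ (1 / 2 : ℝ)) *
          (P ^ (1 / q₀) * (2 * R ^ (2 : ℝ) * (R ^ (3 : ℝ) * b₁)) ^ (1 - 1 / q₀))
        = ENNReal.ofReal (L₁ * 64) * (R ^ (-(3 : ℝ)) * (R ^ (3 : ℝ) * b₁) ^ (1 / 2 : ℝ) *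
            (2 * R ^ (2 : ℝ) * (R ^ (3 : ℝ) * b₁)) ^ (1 - 1 / q₀)) * P ^ (1 / q₀) *
            U ^ (1 / 2 : ℝ) := by ring
      _ = ENNReal.ofReal (L₁ * 64) * (b₁ ^ (1 / 2 : ℝ) * (2 * b₁) ^ (1 - 1 / q₀) *
            R ^ (7 / 2 - 5 / q₀ : ℝ)) * P ^ (1 / q₀) * U ^ (1 / 2 : ℝ) := by
          rw [rpow_bookkeeping_harmonic hR0 hRtop hq1]
      _ = C₁ * R ^ (7 / 2 - 5 / q₀ : ℝ) * P ^ (1 / q₀) * U ^ (1 / 2 : ℝ) := by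
          rw [hC₁]; ring
  have hterm2 : K * U ^ (1 / 2 : ℝ) * (V ^ (1 / 2 : ℝ) *
      ((CW * ENNReal.ofReal (ρ ^ (1 / 2 : ℝ)) * (U + V) ^ (3 / 2 : ℝ)) ^ (2 / 3 : ℝ) *
        volume I ^ (1 / 3 : ℝ)) ^ (1 / 2 : ℝ)) ≤
          C₂ * R ^ (1 / 2 : ℝ) * (U + V) * V ^ (1 / 2 : ℝ) := by
    rw [hvolI, ← ENNReal.ofReal_rpow_of_pos hρ, rpow_bookkeeping_cubic hR0 hRtop]
    have hAE : U ^ (1 / 2 : ℝ) * (U + V) ^ (1 / 2 : ℝ) ≤ U + V :=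
      calc U ^ (1 / 2 : ℝ) * (U + V) ^ (1 / 2 : ℝ)
          ≤ (U + V) ^ (1 / 2 : ℝ) * (U + V) ^ (1 / 2 : ℝ) := by gcongr; exact le_self_add
        _ = U + V := by
            rw [← ENNReal.rpow_add_of_nonneg _ _ (by norm_num) (by norm_num)]; norm_num
    calc (K : ℝ≥0∞) * U ^ (1 / 2 : ℝ) * (V ^ (1 / 2 : ℝ) *
          (CW ^ (1 / 3 : ℝ) * 2 ^ (1 / 6 : ℝ) * R ^ (1 / 2 : ℝ) * (U + V) ^ (1 / 2 : ℝ)))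
        = C₂ * R ^ (1 / 2 : ℝ) * (U ^ (1 / 2 : ℝ) * (U + V) ^ (1 / 2 : ℝ)) * V ^ (1 / 2 : ℝ) := by
          rw [hC₂]; ring
      _ ≤ C₂ * R ^ (1 / 2 : ℝ) * (U + V) * V ^ (1 / 2 : ℝ) := by gcongr
  -- ### assemble
  have hsplit : ∫⁻ s in I, (c₁ * π s) * A₁ s +
      (K * av s ^ (1 / 2 : ℝ) * ev s ^ (1 / 2 : ℝ)) * A₃ s ^ (1 / (3 : ℝ)) =
      (∫⁻ s in I, (c₁ * π s) * A₁ s) +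
        ∫⁻ s in I, (K * av s ^ (1 / 2 : ℝ) * ev s ^ (1 / 2 : ℝ)) * A₃ s ^ (1 / (3 : ℝ)) :=
    lintegral_add_left' ((hπm.const_mul _).mul hA₁m) _
  have hmain : ∫⁻ w in S, ‖p w.1 w.2‖ₑ * ‖u w.1 w.2‖ₑ ≤
      C₁ * R ^ (7 / 2 - 5 / q₀ : ℝ) * P ^ (1 / q₀) * U ^ (1 / 2 : ℝ) +
        C₂ * R ^ (1 / 2 : ℝ) * (U + V) * V ^ (1 / 2 : ℝ) := by
    refine hmix.trans ?_
    rw [hsplit, ← hterm1]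
    exact add_le_add hT1 (hT2.trans hterm2)
  -- multiply by `r⁻¹`
  have hr0 : 0 ≤ r⁻¹ := inv_nonneg.2 hr.le
  have e1 : ENNReal.ofReal r⁻¹ * R ^ (7 / 2 - 5 / q₀ : ℝ) =
      ENNReal.ofReal (r⁻¹ * ρ ^ (2 + 3 / 2 - 5 / q₀)) := by
    rw [hR, ENNReal.ofReal_rpow_of_pos hρ, ← ENNReal.ofReal_mul hr0,
      show (7 / 2 - 5 / q₀ : ℝ) = 2 + 3 / 2 - 5 / q₀ by ring]
  have e2 : ENNReal.ofReal r⁻¹ * R ^ (1 / 2 : ℝ) = ENNReal.ofReal (ρ ^ (1 / 2 : ℝ) / r) := by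
    rw [hR, ENNReal.ofReal_rpow_of_pos hρ, ← ENNReal.ofReal_mul hr0,
      div_eq_inv_mul (ρ ^ (1 / 2 : ℝ)) r]
  set X₁ : ℝ≥0∞ := P ^ (1 / q₀) * U ^ (1 / 2 : ℝ) with hX₁
  set X₂ : ℝ≥0∞ := (U + V) * V ^ (1 / 2 : ℝ) with hX₂
  calc ENNReal.ofReal r⁻¹ * ∫⁻ w in S, ‖p w.1 w.2‖ₑ * ‖u w.1 w.2‖ₑ
      ≤ ENNReal.ofReal r⁻¹ * (C₁ * R ^ (7 / 2 - 5 / q₀ : ℝ) * P ^ (1 / q₀) * U ^ (1 / 2 : ℝ) +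
          C₂ * R ^ (1 / 2 : ℝ) * (U + V) * V ^ (1 / 2 : ℝ)) := mul_le_mul_right hmain _
    _ = C₁ * ((ENNReal.ofReal r⁻¹ * R ^ (7 / 2 - 5 / q₀ : ℝ)) * X₁) +
          C₂ * ((ENNReal.ofReal r⁻¹ * R ^ (1 / 2 : ℝ)) * X₂) := by
        rw [hX₁, hX₂]; ring
    _ ≤ (C₁ + C₂) * ((ENNReal.ofReal r⁻¹ * R ^ (7 / 2 - 5 / q₀ : ℝ)) * X₁) +
          (C₁ + C₂) * ((ENNReal.ofReal r⁻¹ * R ^ (1 / 2 : ℝ)) * X₂) :=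
        add_le_add (mul_le_mul_left le_self_add _) (mul_le_mul_left le_add_self _)
    _ = (C₁ + C₂) * (ENNReal.ofReal (r⁻¹ * ρ ^ (2 + 3 / 2 - 5 / q₀)) * P ^ (1 / q₀) *
            U ^ (1 / 2 : ℝ) +
          ENNReal.ofReal (ρ ^ (1 / 2 : ℝ) / r) * (U + V) * V ^ (1 / 2 : ℝ)) := by
        rw [e1, e2, hX₁, hX₂]; ring

end LemarieRieusset2016

end Literature.Analysis.FluidPDE
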